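import Summits.CriticalPhenomena.PercolationContinuityZ3.Theses.PercBoundarySqueeze
import Summits.CriticalPhenomena.PercolationContinuityZ3.Theorems.QuantitativeBGN.Negative.LoadBearing
import Summits.CriticalPhenomena.PercolationContinuityZ3.Theorems.PercBoundarySqueezeHalfSpaceOneArmRateStubShellSubmult
import HarnessLib.Audit

/-!
# Birth skeleton (BC3) for the crux `HalfSpaceOneArmRate` (stmt-CriticalPhenomena-6983), route `PercBoundarySqueeze`

Registrar: planner-skel-stmt-CriticalPhenomena-6983-0 (2026-08-17), file `Cruxes/HalfSpaceOneArmRate/Lines/birth.lean`.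

The crux (FIXED, the route's decl `…Theses.PercBoundarySqueeze.HalfSpaceOneArmRate`):

  `∃ b C : ℝ, 1/2 < b ∧ ∀ r ≥ 1, P_{p_c(ℤ³)}(arm_H(0,r)) ≤ C r^{-b}`,

`arm_H(0,r) = {∃ y, ‖y‖∞ ≥ r ∧ 0 ↔ y inside H}`, `H = {x | 0 ≤ x 0}` — the same event `armH r` as the sibling crux
`PercLowPointHalfSpace.QuantitativeBGN` (stmt-CriticalPhenomena-0913, `∃ a > 0`), here with the explicit threshold `b > 1/2`
that the route's assembly needs (readback `halfSpaceOneArmRate_iff` below, by `Iff.rfl`).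

LINE (the route header's foreseen split "HalfSpaceShellDefect → DyadicMultiplicativity → Q1", at a general integer ratio `m`
instead of `2`): a multiscale argument in the half-space.

* `stub_shellSubmult` (p-blind plumbing, provable now, size M): **half-space arm submultiplicativity across a shell** — for
  every density `p` and `1 ≤ r < R`,
  `P_p(arm_H(0,R)) ≤ P_p(arm_H(0,r)) · P_p(ShellCross_H(r,R))`, where
  `ShellCross_H(r,R) = {∃ w y, ‖w‖∞ ≤ r+1, ‖y‖∞ ≥ R, w ↔ y open inside H ∩ {‖x‖∞ > r}}`.
  Proof sketch: on lattice configurations an open `H`-path from `0` to sup-distance `R` splits at its LAST visit to `Λ_r`: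
  the initial piece up to the FIRST vertex of sup-norm `r` is an `H`-arm inside `Λ_r` (uses only edges with both ends in
  `Λ_r`), the final piece from the successor of the last `Λ_r`-vertex (sup-norm exactly `r+1`) to the endpoint lies in
  `H ∩ {‖x‖∞ ≥ r+1}` (uses only edges with both ends outside `Λ_r`); the two events are measurable w.r.t. disjoint edge
  sets, hence independent under the product measure (`bondPercolation_indep_edgeSigma`, FiniteEnergy.lean /
  BondPercolationBlockIndependence.lean), and the inner arm is contained in `arm_H(0,r)`.
* `stub_shellDecay` (the OPEN core, crux-class): **quantified half-space shell defect** — at `p_c(ℤ³)` there are an integer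
  ratio `m ≥ 2`, a scale `r₀ ≥ 1` and an exponent `b > 1/2` with `P_{p_c}(ShellCross_H(r, m r)) ≤ m^{-b}` for all `r ≥ r₀`:
  the half-box `Λ_{r+1} ∩ H` is joined inside `H` to sup-distance `m r` with probability beating `m^{-1/2}`, UNIFORMLY in
  `r`. Scaling prediction: `≈ c · m^{-x_s}` with `x_s = 0.975(4)` (Deng–Blöte 2005), so true for `m` large with margin
  `0.47` in the exponent; rigorously open (a scale-uniform bound of RSW / quasi-multiplicativity class in `d = 3`; BGN's
  `θ_H(p_c) = 0` gives `P(ShellCross_H(r,R)) → 0` as `R → ∞` for each FIXED `r`, with no control of the ratio `R/r`).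
  Why it might fail: only through failure of scaling (`x_s ≤ 1/2`, contradicting numerics by 0.47); conversely it follows from
  quasi-multiplicativity + the crux. It is NOT the crux: single ratio, set-to-sphere event, no rate in `r`. It is the half-space,
  thresholded cousin of the bulk items `PercAnnulusCrossing.CritAnnulusNonCrossing` (stmt-0846) / `CritCrossingPolyDecay`
  (stmt-0849) and is NOT implied by them: the bulk set-to-sphere exponent is `β/ν ≈ 0.477 < 1/2`, so the threshold `m^{-1/2}`
  can only be beaten through the WALL's extra repulsion `x_s − β/ν ≈ 0.5` — the honest content of `b > 1/2` relative to 0913.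
* `HalfSpaceOneArmRate_of (h₂ : Registered.stub_shellDecay) : HalfSpaceOneArmRate` (cycle 1 reshape: the CLOSED stub
  `stub_shellSubmult` now enters as a theorem; originally both stubs were hypotheses)
  (PROVED here, ~80 lines; the `Registered.stub_*` aliases name the two stub statements so that the skeleton audit admits
  the hypotheses by name, and the closing `example` plugs the sorried stubs in): the multiscale bookkeeping
  `rate_of_shell_bound` — induction
  `P(arm_H(0, m^k r₀)) ≤ m^{-bk}` from the two stubs, monotonicity of `r ↦ arm_H(0,r)` (`armH_antitone`, Negative lane of
  0913) and the interpolation `m^k r₀ ≤ r < m^{k+1} r₀` (`Nat.log`), giving `C = (m r₀)^b`.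

Negative knowledge honoured (Theorems/QuantitativeBGN/Negative, same event): `armH_lower_bound` (`P(arm_H(0,n+1)) ≥
1/(588 (n+1)²)`, so any `b` is `≤ 2`: `stub_shellDecay` with `b > 2` would be refuted through `stub_shellSubmult` — the stub
only asks `b > 1/2`); `quantitativeBGN_false_without_rPos` (`armH 0 = univ`: the guards `1 ≤ r`, `1 ≤ r₀` are kept);
`not_uniform_above` (everything is at `p = p_c` exactly, except the p-blind `stub_shellSubmult`, true at every `p`).
`ledger negatives --problem CriticalPhenomena`: no refuted statement concerns half-space shell crossings.
-/

noncomputable section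

namespace Summit.CriticalPhenomena.PercolationContinuityZ3.Cruxes.HalfSpaceOneArmRate.Birth

open MeasureTheory
open Literature.Probability.Percolation Literature.Probability.LatticeModels
open Summit.CriticalPhenomena.PercolationContinuityZ3.Theses.PercBoundarySqueeze (HalfSpaceOneArmRate)
open Summit.CriticalPhenomena.PercolationContinuityZ3.Theorems.QuantitativeBGN.Negative
  (armH armH_antitone)

/-! ## Readback and the line's one new event -/

/-- READBACK: the crux is literally the rate statement for the event `armH r` of the 0913 Negative lane under
`P_{p_c(ℤ³)}`. [folklore] -/
theorem halfSpaceOneArmRate_iff :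
    HalfSpaceOneArmRate ↔ ∃ b C : ℝ, 1 / 2 < b ∧ ∀ r : ℕ, 1 ≤ r →
      (bondPercolation (zdGraph 3) (criticalProbI 3)).real (armH r) ≤ C * (r : ℝ) ^ (-b) :=
  Iff.rfl

/-- The half-space SHELL-CROSSING event `ShellCross_H(r,R)`: some vertex of sup-norm `≤ r+1` is joined to sup-distance
`≥ R` by an open path all of whose vertices lie in `H ∩ {‖x‖∞ > r}` (the stubs spell this set out verbatim). [folklore] -/
def shellCross (r R : ℕ) : Set (BondConfig (Site 3)) :=
  {ω | ∃ w y : Site 3, (∀ i : Fin 3, |w i| ≤ (r : ℤ) + 1) ∧ (∃ i : Fin 3, (R : ℤ) ≤ |y i|) ∧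
    ω ∈ openConnIn {x : Site 3 | 0 ≤ x 0 ∧ ∃ i : Fin 3, (r : ℤ) < |x i|} w y}

/-- Statement of `stub_shellSubmult` (named; the registered stub below spells it out verbatim). [folklore] -/
abbrev ShellSubmultStmt : Prop :=
  ∀ p : unitInterval, ∀ r R : ℕ, 1 ≤ r → r < R →
    (bondPercolation (zdGraph 3) p).real (armH R) ≤
      (bondPercolation (zdGraph 3) p).real (armH r) *
        (bondPercolation (zdGraph 3) p).real
          {ω | ∃ w y : Site 3, (∀ i : Fin 3, |w i| ≤ (r : ℤ) + 1) ∧ (∃ i : Fin 3, (R : ℤ) ≤ |y i|) ∧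
            ω ∈ openConnIn {x : Site 3 | 0 ≤ x 0 ∧ ∃ i : Fin 3, (r : ℤ) < |x i|} w y}

/-- Statement of `stub_shellDecay` (named; the registered stub below spells it out verbatim). [folklore] -/
abbrev ShellDecayStmt : Prop :=
  ∃ (m r₀ : ℕ) (b : ℝ), 2 ≤ m ∧ 1 ≤ r₀ ∧ 1 / 2 < b ∧ ∀ r : ℕ, r₀ ≤ r →
    (bondPercolation (zdGraph 3) (criticalProbI 3)).real
        {ω | ∃ w y : Site 3, (∀ i : Fin 3, |w i| ≤ (r : ℤ) + 1) ∧ (∃ i : Fin 3, ((m * r : ℕ) : ℤ) ≤ |y i|) ∧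
          ω ∈ openConnIn {x : Site 3 | 0 ≤ x 0 ∧ ∃ i : Fin 3, (r : ℤ) < |x i|} w y} ≤ (m : ℝ) ^ (-b)

/-- `shellCross` is the event spelled out in the stubs. [folklore] -/
theorem shellCross_eq (r R : ℕ) : shellCross r R =
    {ω | ∃ w y : Site 3, (∀ i : Fin 3, |w i| ≤ (r : ℤ) + 1) ∧ (∃ i : Fin 3, (R : ℤ) ≤ |y i|) ∧
      ω ∈ openConnIn {x : Site 3 | 0 ≤ x 0 ∧ ∃ i : Fin 3, (r : ℤ) < |x i|} w y} := rfl

/-! ## Registered stubs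

Status (lead prover-line-stmt-CriticalPhenomena-6983-0, cycle 1): `stub_shellSubmult` CLOSED (p148307,
`Summit.CriticalPhenomena.PercolationContinuityZ3.Theorems.stub_shellSubmult`); `stub_shellDecay` OPEN (the only `sorry`). -/

/-- **stub_shellSubmult (p-blind plumbing; provable now; size M).** Half-space arm submultiplicativity across a shell:
for every `p` and `1 ≤ r < R`, `P_p(arm_H(0,R)) ≤ P_p(arm_H(0,r)) · P_p(ShellCross_H(r,R))` (last-exit decomposition of
an open `H`-path at `Λ_r` + independence of disjoint edge sets under the product measure). -/
theorem stub_shellSubmult : ∀ p : unitInterval, ∀ r R : ℕ, 1 ≤ r → r < R →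
    (bondPercolation (zdGraph 3) p).real (armH R) ≤
      (bondPercolation (zdGraph 3) p).real (armH r) *
        (bondPercolation (zdGraph 3) p).real
          {ω | ∃ w y : Site 3, (∀ i : Fin 3, |w i| ≤ (r : ℤ) + 1) ∧ (∃ i : Fin 3, (R : ℤ) ≤ |y i|) ∧
            ω ∈ openConnIn {x : Site 3 | 0 ≤ x 0 ∧ ∃ i : Fin 3, (r : ℤ) < |x i|} w y} :=
  -- CLOSED (wave 1, p148307): landed as `Theorems/PercBoundarySqueezeHalfSpaceOneArmRateStubShellSubmult.lean`
  Summit.CriticalPhenomena.PercolationContinuityZ3.Theorems.stub_shellSubmult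

/-- **stub_shellDecay (OPEN core; crux-class).** Quantified half-space shell defect at `p_c(ℤ³)`: for some integer ratio
`m ≥ 2`, scale `r₀ ≥ 1` and exponent `b > 1/2`, `P_{p_c}(ShellCross_H(r, m r)) ≤ m^{-b}` for every `r ≥ r₀` (scaling:
`≈ c m^{-x_s}`, `x_s ≈ 0.975`; necessarily `b ≤ 2` by `armH_lower_bound` + `stub_shellSubmult`). -/
theorem stub_shellDecay : ∃ (m r₀ : ℕ) (b : ℝ), 2 ≤ m ∧ 1 ≤ r₀ ∧ 1 / 2 < b ∧ ∀ r : ℕ, r₀ ≤ r →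
    (bondPercolation (zdGraph 3) (criticalProbI 3)).real
        {ω | ∃ w y : Site 3, (∀ i : Fin 3, |w i| ≤ (r : ℤ) + 1) ∧ (∃ i : Fin 3, ((m * r : ℕ) : ℤ) ≤ |y i|) ∧
          ω ∈ openConnIn {x : Site 3 | 0 ≤ x 0 ∧ ∃ i : Fin 3, (r : ℤ) < |x i|} w y} ≤ (m : ℝ) ^ (-b) := by
  sorry

theorem shellSubmult_holds : ShellSubmultStmt := stub_shellSubmult
theorem shellDecay_holds : ShellDecayStmt := stub_shellDecay

namespace Registered

/-- Alias of `ShellSubmultStmt` keyed by the registered stub name (the skeleton audit admits hypotheses by name). -/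
abbrev stub_shellSubmult : Prop := ShellSubmultStmt
/-- Alias of `ShellDecayStmt` keyed by the registered stub name. -/
abbrev stub_shellDecay : Prop := ShellDecayStmt

end Registered

/-! ## The multiscale bookkeeping (proved) -/

/-- **Geometric-to-polynomial bookkeeping.** If `P : ℕ → (-∞,1]` is non-increasing and submultiplicative across shells
with factors `Q r R ≥ 0`, and the factor at ratio `m ≥ 2` is at most `m^{-b}` (`b > 0`) from scale `r₀ ≥ 1` on, then
`P r ≤ (m r₀)^b · r^{-b}` for every `r ≥ 1`. [folklore] -/
theorem rate_of_shell_bound (P : ℕ → ℝ) (Q : ℕ → ℕ → ℝ)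
    (hP1 : ∀ r, P r ≤ 1) (hanti : Antitone P) (hQ0 : ∀ r R, 0 ≤ Q r R)
    (hsub : ∀ r R : ℕ, 1 ≤ r → r < R → P R ≤ P r * Q r R)
    {m r₀ : ℕ} {b : ℝ} (hm : 2 ≤ m) (hr₀ : 1 ≤ r₀) (hb : 0 < b)
    (hQ : ∀ r : ℕ, r₀ ≤ r → Q r (m * r) ≤ (m : ℝ) ^ (-b)) :
    ∀ r : ℕ, 1 ≤ r → P r ≤ ((m : ℝ) * r₀) ^ b * (r : ℝ) ^ (-b) := by
  have hm1 : 1 < m := lt_of_lt_of_le one_lt_two hm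
  have hmR : (0 : ℝ) < m := by exact_mod_cast (lt_trans zero_lt_one hm1)
  have hr₀R : (0 : ℝ) < r₀ := by exact_mod_cast hr₀
  have hq0 : (0 : ℝ) ≤ (m : ℝ) ^ (-b) := Real.rpow_nonneg hmR.le _
  -- Step 1: geometric decay along the scales `m^k r₀`.
  have hgeo : ∀ k : ℕ, P (m ^ k * r₀) ≤ ((m : ℝ) ^ (-b)) ^ k := by
    intro k
    induction k with
    | zero => simpa using hP1 r₀
    | succ k ih =>
      have hmk : 1 ≤ m ^ k := Nat.one_le_pow _ _ (lt_trans zero_lt_one hm1)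
      have hr : 1 ≤ m ^ k * r₀ := le_trans hr₀ (Nat.le_mul_of_pos_left r₀ hmk)
      have hrR : m ^ k * r₀ < m ^ (k + 1) * r₀ :=
        Nat.mul_lt_mul_of_pos_right (Nat.pow_lt_pow_right hm1 (Nat.lt_succ_self k)) hr₀
      have h1 := hsub _ _ hr hrR
      have h2 : Q (m ^ k * r₀) (m ^ (k + 1) * r₀) ≤ (m : ℝ) ^ (-b) := by
        have h := hQ (m ^ k * r₀) (Nat.le_mul_of_pos_left r₀ hmk)
        have e : m * (m ^ k * r₀) = m ^ (k + 1) * r₀ := by ring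
        rw [e] at h
        exact h
      calc P (m ^ (k + 1) * r₀) ≤ P (m ^ k * r₀) * Q (m ^ k * r₀) (m ^ (k + 1) * r₀) := h1
        _ ≤ ((m : ℝ) ^ (-b)) ^ k * (m : ℝ) ^ (-b) := mul_le_mul ih h2 (hQ0 _ _) (pow_nonneg hq0 k)
        _ = ((m : ℝ) ^ (-b)) ^ (k + 1) := by rw [pow_succ]
  -- Step 2: every `r ≥ 1` sits in a window `m^k r₀ ≤ r < m^(k+1) r₀` (or below `r₀`, with `k = 0`).
  have hwin : ∀ r : ℕ, 1 ≤ r → ∃ k : ℕ, P r ≤ ((m : ℝ) ^ (-b)) ^ k ∧ (r : ℝ) ≤ (m : ℝ) ^ k * ((m : ℝ) * r₀) := by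
    intro r hr
    by_cases hlt : r < r₀
    · refine ⟨0, ?_, ?_⟩
      · simpa using hP1 r
      · have h1 : (r : ℝ) ≤ r₀ := by exact_mod_cast hlt.le
        have h2 : (r₀ : ℝ) ≤ (m : ℝ) * r₀ := le_mul_of_one_le_left hr₀R.le (by exact_mod_cast hm1.le)
        simpa using h1.trans h2
    · rw [not_lt] at hlt
      set n := r / r₀ with hn
      have hn0 : n ≠ 0 := by
        rw [hn]
        exact (Nat.div_pos hlt (lt_of_lt_of_le zero_lt_one hr₀)).ne'
      set k := Nat.log m n with hk
      refine ⟨k, ?_, ?_⟩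
      · -- `m^k r₀ ≤ r`, so `P r ≤ P (m^k r₀) ≤ (m^{-b})^k`
        have hle : m ^ k * r₀ ≤ r := by
          calc m ^ k * r₀ ≤ n * r₀ := Nat.mul_le_mul_right r₀ (Nat.pow_log_le_self m hn0)
            _ ≤ r := Nat.div_mul_le_self r r₀
        exact (hanti hle).trans (hgeo k)
      · -- `r < (n+1) r₀ ≤ m^(k+1) r₀ = m^k · (m r₀)`
        have hlt' : r < m ^ (k + 1) * r₀ := by
          have h1 : r < n * r₀ + r₀ := Nat.lt_div_mul_add (lt_of_lt_of_le zero_lt_one hr₀)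
          have h2 : n + 1 ≤ m ^ (k + 1) := Nat.lt_pow_succ_log_self hm1 n
          calc r < (n + 1) * r₀ := by simpa [add_mul] using h1
            _ ≤ m ^ (k + 1) * r₀ := Nat.mul_le_mul_right r₀ h2
        have h3 : (r : ℝ) ≤ ((m ^ (k + 1) * r₀ : ℕ) : ℝ) := by exact_mod_cast hlt'.le
        have e : ((m ^ (k + 1) * r₀ : ℕ) : ℝ) = (m : ℝ) ^ k * ((m : ℝ) * r₀) := by push_cast; ring
        rw [e] at h3
        exact h3
  -- Step 3: convert `(m^{-b})^k` into `(m r₀)^b · r^{-b}` on the window.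
  intro r hr
  obtain ⟨k, hPk, hrk⟩ := hwin r hr
  have hrR : (0 : ℝ) < r := by exact_mod_cast hr
  have hmk : (0 : ℝ) < (m : ℝ) ^ k := pow_pos hmR k
  have hmr₀ : (0 : ℝ) < (m : ℝ) * r₀ := mul_pos hmR hr₀R
  -- `(m^{-b})^k = (m^k)^{-b}`
  have e1 : ((m : ℝ) ^ (-b)) ^ k = ((m : ℝ) ^ k) ^ (-b) := by
    rw [← Real.rpow_natCast, ← Real.rpow_mul hmR.le, mul_comm, Real.rpow_mul hmR.le, Real.rpow_natCast]
  -- antitonicity of `x ↦ x^{-b}` on the window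
  have e2 : ((m : ℝ) ^ k * ((m : ℝ) * r₀)) ^ (-b) ≤ (r : ℝ) ^ (-b) :=
    Real.rpow_le_rpow_of_nonpos hrR hrk (by linarith)
  have e3 : ((m : ℝ) ^ k) ^ (-b) = ((m : ℝ) ^ k * ((m : ℝ) * r₀)) ^ (-b) * ((m : ℝ) * r₀) ^ b := by
    rw [Real.mul_rpow hmk.le hmr₀.le, mul_assoc, Real.rpow_neg hmr₀.le,
      inv_mul_cancel₀ (Real.rpow_pos_of_pos hmr₀ b).ne', mul_one]
  calc P r ≤ ((m : ℝ) ^ (-b)) ^ k := hPk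
    _ = ((m : ℝ) ^ k * ((m : ℝ) * r₀)) ^ (-b) * ((m : ℝ) * r₀) ^ b := by rw [e1, e3]
    _ ≤ (r : ℝ) ^ (-b) * ((m : ℝ) * r₀) ^ b :=
      mul_le_mul_of_nonneg_right e2 (Real.rpow_nonneg hmr₀.le b)
    _ = ((m : ℝ) * r₀) ^ b * (r : ℝ) ^ (-b) := mul_comm _ _

/-! ## Composition: the two stubs prove the crux BY NAME -/

/-- **Composition (kernel-checked, no `sorry`).** `stub_shellDecay → HalfSpaceOneArmRate` (the closed stub
`stub_shellSubmult` is used as a theorem inside):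
unpack `m, r₀, b` from the shell-decay stub and run `rate_of_shell_bound` with `P r = P_{p_c}(arm_H(0,r))`,
`Q r R = P_{p_c}(ShellCross_H(r,R))`, the submultiplicativity stub at `p = p_c`, `armH_antitone` and `0 ≤ P ≤ 1`. -/
theorem HalfSpaceOneArmRate_of (h₂ : Registered.stub_shellDecay) :
    Summit.CriticalPhenomena.PercolationContinuityZ3.Theses.PercBoundarySqueeze.HalfSpaceOneArmRate := by
  -- `stub_shellSubmult` is CLOSED (p148307): it enters as a theorem, no longer as a hypothesis.
  have h₁ : Registered.stub_shellSubmult := shellSubmult_holds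
  obtain ⟨m, r₀, b, hm, hr₀, hb, hQ⟩ := h₂
  rw [halfSpaceOneArmRate_iff]
  refine ⟨b, ((m : ℝ) * r₀) ^ b, hb, ?_⟩
  refine rate_of_shell_bound (fun r => (bondPercolation (zdGraph 3) (criticalProbI 3)).real (armH r))
    (fun r R => (bondPercolation (zdGraph 3) (criticalProbI 3)).real
      {ω | ∃ w y : Site 3, (∀ i : Fin 3, |w i| ≤ (r : ℤ) + 1) ∧ (∃ i : Fin 3, (R : ℤ) ≤ |y i|) ∧
        ω ∈ openConnIn {x : Site 3 | 0 ≤ x 0 ∧ ∃ i : Fin 3, (r : ℤ) < |x i|} w y})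
    (fun r => measureReal_le_one)
    (fun r s hrs => measureReal_mono (armH_antitone hrs)) (fun r R => measureReal_nonneg)
    (fun r R hr hrR => h₁ (criticalProbI 3) r R hr hrR) hm hr₀ (by linarith) ?_
  intro r hr
  exact hQ r hr

/-- Wiring check: plugging the (sorried) registered stubs into the composition yields the crux — the spelled-out stub
signatures are definitionally the `Registered.*` aliases. -/
example : Summit.CriticalPhenomena.PercolationContinuityZ3.Theses.PercBoundarySqueeze.HalfSpaceOneArmRate :=
  HalfSpaceOneArmRate_of stub_shellDecay

end Summit.CriticalPhenomena.PercolationContinuityZ3.Cruxes.HalfSpaceOneArmRate.Birth
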